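import Literature.AnabelianGeometry.SemiGraphs.TemperedSpecialFibreReductions
import Literature.AnabelianGeometry.SemiGraphs.TemperedCuspOmissionHypotheses
import HarnessLib

/-!
# [SemiAnbd] Cor. 3.11, proof step (C): the isomorphism of the graphs of anabelioids of the special
# fibres [without compact structure] extends uniquely along the CUSPS (statements)

Mochizuki, *Semi-graphs of anabelioids*, Publ. RIMS **42** (2006), §3, Corollary 3.11, proof, manuscript
pp. 46–47 = PRIMS pp. 272 l. −14 – 273 l. −8 [cite: MochizukiSemiAnbd2006, Cor 3.11 pp.46-47]: "by
Corollary 3.9, we conclude that `γ` induces a natural, functorial isomorphism of graphs of anabelioids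
`G[α]_Σ ⥲ G[β]_Σ` … (i) The technique … may also be applied to open subgroups of finite index … that
correspond via `γ`. (ii) The decomposition groups of cusps in `Δ[□]^Σ` are commensurably terminal [cf.
[Mzk3], Lemma 1.3.7]. (iii) Every nontrivial image … of the decomposition group of a node … is either an
open subgroup of an edge-like subgroup of `Δ[□]^Σ` or an open subgroup of a decomposition group of a cusp
… [but not both, since `G[□]_Σ` is totally aloof …]. (iv) Every decomposition group of a cusp in `Δ[□]^Σ`
admits an open subgroup that arises as the image … of an edge-like subgroup of `Δ'[□]^Σ` … Thus, in
summary, it follows formally from (i), (ii), (iii), (iv) that the natural, functorial isomorphism of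
graphs of anabelioids `G[α]_Σ ⥲ G[β]_Σ` induced by `γ` extends uniquely to a natural, functorial
isomorphism of semi-graphs of anabelioids `G^c[α]_Σ ⥲ G^c[β]_Σ` [which may also be regarded as being
induced by `γ`]".

STATEMENTS file (abc-iut cell, layer L3, sub-DAG `plan/L3/SUBDAG-SemiAnbd-Cor311.md` sub-node C; seat
abc-iut-w4-d083, L3-lead ruling α89).  Over the origin hypotheses `Ωα Ωβ : SpecialFibreOrigin` of
`TemperedSpecialFibre.lean` (assumed by consumers, asserted for no instance — FACT-policy, like the steps
(S1)–(S3′) of `TemperedSpecialFibreReductions(Descended).lean`) and at `Σ` = all primes (the level of the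
tree's `SpecialFibreData`):

* `SpecialFibreData.graph S` — "`G[□]` … the graph of anabelioids [without compact structure!]" (Cor. 3.11
  p. 45): the semi-graph of anabelioids `G^c[□]` of the special fibre with all open edges (cusps) omitted
  (§1 p. 13, the maximal subgraph; by abc-iut-f-177's `cor39Hypotheses_restrict_maximalSubgraph` it is a
  GRAPH of anabelioids satisfying the hypotheses of Cor. 3.9, with the same `π₁^temp`, [IUTchI] §2 p. 44 —
  recorded as `SpecialFibreData.cor39Hypotheses_graph` in the proof-only sequel);
* `SpecialFibreData.GraphCompatible` — compatibility of an isomorphism `F₀ : G[α] ⥲ G[β]` with an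
  isomorphism `φ` of the tempered fundamental groups of the special fibres on verticial AND edge
  homomorphisms (the shape of `Hom.CompatV` / `Hom.CompatE`, through the charts of `G^c[□]`: the vertex and
  edge groups of `G[□]` are those of `G^c[□]`, `restrict_Gv` / `restrict_Ge`);
* `ProfiniteSemiGraph.Hom.ExtendsBase` — "`F : G^c[α] → G^c[β]` extends `F₀ : G[α] → G[β]`" on
  underlying semi-graphs;
* `CuspExtensionUnique Ωα Ωβ` — step (C): for `φ` DESCENDED from `γ` (as in (S3′)), every locally open
  morphism of graphs of anabelioids `F₀ : G[α] → G[β]` compatible with `φ` extends to an isomorphism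
  `F : G^c[α] ⥲ G^c[β]` of semi-graphs of anabelioids with compact structure, chart-compatible with `φ`,
  and such an extension is UNIQUE on the cusps: two chart-compatible isomorphisms agreeing on vertices and
  nodes agree on every edge.  Ingredient (ii) of the printed proof is the FACT-LIST row F-0003
  `Literature.AnabelianGeometry.AbsoluteAnabelian.CuspidalData.InertiaCommensurablyTerminal` ([AbsAnab]
  Lem. 1.3.7), consumed BY NAME by whoever discharges (C) at a genuine origin; (iv) is geometric
  (coverings "ramified over the irreducible component … that contains the cusp", collapsing components,
  [Tama2] Thm. 0.2); (C) is therefore typed, not proved.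

The finite-graph reduction «(S3′) ⇐ Cor. 3.9 at the (finite) graphs `G[□]` + (C)» is the proof-only
sequel `TemperedSpecialFibreCuspsReduction.lean`.  No statement of the frozen files is altered; nothing
here takes a side on [IUTchIII] Cor. 3.12; typed ≠ proved.
-/

open CategoryTheory Topology

noncomputable section

namespace Literature.AnabelianGeometry.SemiGraphs

open ProfiniteSemiGraph

universe u

/-! ### `G[□]`: the graph of anabelioids of the special fibre, cusps omitted -/

namespace SpecialFibreData

variable {K : Type u} [Field K] {D : TemperedArithmeticGroup K}

/-- "`G[□]` … the graph of anabelioids [without compact structure!]" of the special fibre ([SemiAnbd]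
Cor. 3.11 p. 45; Ex. 3.10 p. 44 "`B^temp(G) ⥲ B^temp(G^c)`"): `G^c[□]` restricted to its maximal
subgraph (all open edges = cusps omitted, §1 p. 13); its underlying semi-graph is `S.graph.graph`, with
vertices `{v // v ∈ Set.univ}` and edges the closed edges of `G^c[□]`.
[cite: MochizukiSemiAnbd2006, Cor 3.11 p.45] -/
abbrev graph (S : SpecialFibreData D) : ProfiniteSemiGraph.{u} :=
  S.Gc.restrict S.Gc.graph.maximalSubgraph

end SpecialFibreData

/-! ### Extension of morphisms along the cusps; compatibility of `F₀ : G[α] → G[β]` with `φ` -/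

/-- `F : 𝒢 → ℋ` *extends* `F₀ : 𝒢|_H → ℋ|_{H'}` on underlying semi-graphs: the same vertex map and the
same edge map on the sub-semi-graphs (Cor. 3.11 proof p. 47 "extends").
[cite: MochizukiSemiAnbd2006, Cor 3.11 p.47] -/
def ProfiniteSemiGraph.Hom.ExtendsBase {𝒢 ℋ : ProfiniteSemiGraph.{u}} {H : 𝒢.graph.Subgraph}
    {H' : ℋ.graph.Subgraph} (F : Hom 𝒢 ℋ) (F₀ : Hom (𝒢.restrict H) (ℋ.restrict H')) : Prop :=
  (∀ v : H.toSemiGraph.Vertex, F.base.vertexMap v.1 = (F₀.base.vertexMap v).1) ∧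
    ∀ e : H.toSemiGraph.Edge, F.base.edgeMap e.1 = (F₀.base.edgeMap e).1

section Cor311

variable {Kα : Type u} [Field Kα] {Kβ : Type u} [Field Kβ]

/-- Compatibility of a morphism of the graphs of anabelioids WITHOUT compact structure
`F₀ : G[α] → G[β]` with an isomorphism `φ : π₁^temp(G^c[α]) ⥲ π₁^temp(G^c[β])` of the tempered
fundamental groups of the special fibres (p. 46 "`γ` induces … `G[α]_Σ ⥲ G[β]_Σ`"; Prop. 3.6 (iv), Thm.
3.7 (i), (iii)): `φ` is compatible, up to conjugation, with the verticial homomorphisms at `v`, `F₀ v`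
and with the edge homomorphisms at every NODE `e`, `F₀ e` — read through the charts of `G^c[□]`, whose
vertex / edge groups and tempered fundamental group are those of `G[□]` (cusp omission, [IUTchI] §2
p. 44; tree `restrict_Gv`, `restrict_Ge`, `exists_cor39Hypotheses_and_chart_restrict_maximalSubgraph`).
[cite: MochizukiSemiAnbd2006, Cor 3.11 p.46] -/
def SpecialFibreData.GraphCompatible {Dα : TemperedArithmeticGroup Kα} {Dβ : TemperedArithmeticGroup Kβ}
    (Sα : SpecialFibreData Dα) (Sβ : SpecialFibreData Dβ) (φ : Sα.chart.G ≃ₜ* Sβ.chart.G)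
    (F₀ : Hom Sα.graph Sβ.graph) : Prop :=
  (∀ (v : Sα.graph.graph.Vertex) (ψα : Sα.Gc.Gv v.1 →ₜ* Sα.chart.G)
      (ψβ : Sβ.Gc.Gv (F₀.base.vertexMap v).1 →ₜ* Sβ.chart.G),
      IsVerticialHom Sα.chart v.1 ψα → IsVerticialHom Sβ.chart (F₀.base.vertexMap v).1 ψβ →
        ∃ g : Sβ.chart.G, ∀ x, φ (ψα x) = g * ψβ (F₀.hV v x) * g⁻¹) ∧
    ∀ (e : Sα.graph.graph.Edge) (ψα : Sα.Gc.Ge e.1 →ₜ* Sα.chart.G)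
      (ψβ : Sβ.Gc.Ge (F₀.base.edgeMap e).1 →ₜ* Sβ.chart.G),
      IsEdgeHom Sα.chart e.1 ψα → IsEdgeHom Sβ.chart (F₀.base.edgeMap e).1 ψβ →
        ∃ g : Sβ.chart.G, ∀ x, φ (ψα x) = g * ψβ (F₀.hE e x) * g⁻¹

/-- (C) **The isomorphism of graphs of anabelioids induced by `γ` extends uniquely along the cusps**
([SemiAnbd] Cor. 3.11, proof, pp. 46–47 = PRIMS p. 272 l. −14 – p. 273 l. −8: "it follows formally from
(i), (ii), (iii), (iv) that the natural, functorial isomorphism of graphs of anabelioids `G[α]_Σ ⥲ G[β]_Σ`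
induced by `γ` extends uniquely to a natural, functorial isomorphism of semi-graphs of anabelioids
`G^c[α]_Σ ⥲ G^c[β]_Σ` [which may also be regarded as being induced by `γ`]"), named residual step over the
origin hypotheses (assumed by consumers, asserted for no instance), in the γ-DESCENDED shape of (S3′): for
`γ : Δ[α] ⥲ Δ[β]`, `φ` descended from `γ` along the admissible quotients, and every locally open morphism
of graphs of anabelioids `F₀ : G[α] → G[β]` compatible with `φ` (what Cor. 3.9 (b) delivers; print: "an
isomorphism of graphs of anabelioids", which such an `F₀` is at a genuine origin, `φ` being one) —
EXISTENCE: an isomorphism `F : G^c[α] ⥲ G^c[β]` of the semi-graphs of anabelioids with compact structure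
extending `F₀` on underlying semi-graphs and chart-compatible with `φ`; UNIQUENESS
on the cusps: two chart-compatible isomorphisms `G^c[α] ⥲ G^c[β]` with the same vertex map and the same
image of every node have the same edge map.  Printed ingredients: (i) Cor. 3.9 at corresponding open
subgroups; (ii) = FACT-LIST F-0003 `AbsoluteAnabelian.CuspidalData.InertiaCommensurablyTerminal`
([AbsAnab] Lem. 1.3.7), by name; (iii) total aloofness (Ex. 2.10, Rmk. 2.4.1); (iv) geometric (coverings
ramified over the component carrying the cusp; [Tama2] Thm. 0.2) — whence typed, not proved.
[cite: MochizukiSemiAnbd2006, Cor 3.11 pp.46-47] -/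
def CuspExtensionUnique (Ωα : SpecialFibreOrigin Kα) (Ωβ : SpecialFibreOrigin Kβ) : Prop :=
  ∀ (Dα : TemperedArithmeticGroup Kα) (Dβ : TemperedArithmeticGroup Kβ)
    (Sα : SpecialFibreData Dα) (Sβ : SpecialFibreData Dβ),
    Ωα.IsSpecialFibreOf Dα Sα → Ωβ.IsSpecialFibreOf Dβ Sβ →
    ∀ (γ : Dα.delta ≃ₜ* Dβ.delta) (φ : Sα.chart.G ≃ₜ* Sβ.chart.G),
      (∀ x : Dα.delta, φ (Sα.admissible x) = Sβ.admissible (γ x)) →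
      (∀ F₀ : Hom Sα.graph Sβ.graph, F₀.IsLocallyOpen → Sα.GraphCompatible Sβ φ F₀ →
          ∃ F : Hom Sα.Gc Sβ.Gc, F.IsIso ∧ F.ExtendsBase F₀ ∧ Sα.ChartCompatible Sβ φ F) ∧
        ∀ F F' : Hom Sα.Gc Sβ.Gc, F.IsIso → F'.IsIso →
          Sα.ChartCompatible Sβ φ F → Sα.ChartCompatible Sβ φ F' →
          F'.base.vertexMap = F.base.vertexMap →
          (∀ e : Sα.graph.graph.Edge, F'.base.edgeMap e.1 = F.base.edgeMap e.1) →
            F'.base.edgeMap = F.base.edgeMap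

end Cor311

end Literature.AnabelianGeometry.SemiGraphs

end
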